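import Summits.ValiantsHypothesis.ValiantsHypothesis.Theorems.LacunarySymmetroidMatrixDescartesCensusDoorA34FlagInertia

/-!
# `MatrixDescartes` census — DEAD DEFINITE ENDS: beyond its last determinant root, a real symmetric lacunary pencil with a
# DEFINITE end letter is definite, so no flag window at that end carries an alternation (all sizes `m`, all supports)

HONEST FRAMING.  Cell `val-V1-extremal` (engine seat val-v1x-eng-6 g5, the `m = 2, 3` row lineage), helper file `--supports` the crux
`Theses.LacunarySymmetroid.MatrixDescartes` (stmt-ValiantsHypothesis-18050), which is OPEN and asserted nowhere here.  STRUCTURE mathematics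
in census (CONJECTURE-A) currency about the cell's END / FLAG mechanism; it proves nothing about the crux (an upper bound at fat formats),
nothing about `DoorA26` / `DoorA34`, nothing about `VP ≠ VNP`.  No definitions, no `sorry`.

CONTEXT.  The tree's FLAG CERTIFICATE (`Census.Graft.exists_flag_certificate`, seat val-sym-mdr-p1) turns sign alternations of the trailing
principal minors of a source pencil `P(x) = ∑ₖ x^{dₖ} Sₖ` (in the frame of the intended flag) located in WINDOWS beyond the source's certificate
into extra roots of the grafted `(K+1)`-letter pencil: a far letter at an end is worth `m` junction alternations PLUS the within-window alternations
(«flag capacity», the census's `Σγ`).  This file proves the elementary law that such windows are EMPTY at a DEFINITE end: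

* `sum_pow_smul_eq_pow_smul_shift` / `shift_eval_zero` — bookkeeping: `∑ x^{dₖ}Sₖ = x^{d₀} • ∑ x^{dₖ−d₀}Sₖ` and the shifted pencil equals the
  end letter at `x = 0`;
* **`posDef_of_posDef_bottom`** — if the BOTTOM letter `S k₀` (strictly smallest exponent) is positive definite and `det P ≠ 0` on `(0, T]`, then
  `P(x) ≻ 0` for every `x ∈ (0, T]`.  PROOF: the negative index of the shifted pencil is constant on the root-free window `[0, x]`
  (`Census.FlagInertia.negIndex_eq_of_det_ne_zero_Icc`, from the tree's inertia law `Inertia.negIndex_dist_le_sum_corank`) and is `0` at `x = 0`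
  (positive eigenvalues of `S k₀`); index `0` and `det ≠ 0` give definiteness (`Census.FlagInertia.posDef_of_negIndex_eq_zero`); scale back by `x^{d₀} > 0`.
* **`posDef_of_posDef_top`** — the mirror statement at the TOP end (`S k₀` of strictly largest exponent, `det P ≠ 0` on `[T, ∞)`, `T > 0`), by the
  reversal `u = x⁻¹`: `∑ u^{d₀−dₖ}Sₖ = u^{d₀} • P(u⁻¹)`.  Negative definite ends: `negDef` versions via `S ↦ −S`
  (`posDef_neg_of_posDef_neg_bottom/top`).
* **`det_frame_minor_pos_of_posDef_top`** (the flag reading) — consequently, for ANY frame `C` with injective `C.mulVec` (e.g. orthogonal) and ANY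
  injective coordinate selection `f`, the window carrier `det ((Cᵀ P(x) C).submatrix f f)` is POSITIVE beyond `T`; in particular two scales
  `T ≤ x, y` never give it opposite signs (`not_alternating_frame_minor_of_posDef_top`): the within-window hypotheses of the flag certificate cannot be
  met beyond the last root at a definite end — a far letter there is worth exactly the `m` junction alternations of the GRAFT LAW
  (`Graft.exists_alternating_succ`), never `m + Σγ` with `Σγ > 0`.

LOCATED READING (seat report HOME/eng-6/g5/REPORT-g5.md, the m = 3 END-YIELD TABLE over 339 census `(3,4)` cores, both ends, exact):
all 65 ends with a definite end letter have flag capacity `(γ₁,γ₂) = (0,0)`; 600 of the 613 indefinite ends have capacity `≥ 1`, modal value the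
«perfect flag» `(2,1)`.  Finite located evidence for the dictionary; the theorem above is the `65/65` column.  [folklore] Sylvester's law of inertia /
continuity of the inertia of a nonsingular symmetric family; elementary.
-/

-- `Summit.ValiantsHypothesis.ValiantsHypothesis.…` repeats a component by the D-0017 layout
-- (single-conjunct summit), which the `dupNamespace` linter flags; the name is mandated.
set_option linter.dupNamespace false

namespace Summit.ValiantsHypothesis.ValiantsHypothesis.Theorems.LacunarySymmetroidMatrixDescartes.Census.DeadEnd

open Matrix Finset
open scoped BigOperators
open Summit.ValiantsHypothesis.ValiantsHypothesis.Theorems.LacunarySymmetroidMatrixDescartes.Census.FlagInertia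
  (negIndex_eq_of_det_ne_zero_Icc posDef_of_negIndex_eq_zero)

variable {ι : Type} [Fintype ι] [DecidableEq ι] {κ : Type} [Fintype κ]

/-! ### Bookkeeping: shifting the support to the end letter -/

omit [Fintype ι] [DecidableEq ι] [Fintype κ] in
/-- Factoring out the smallest exponent: `∑ x^{dₖ} Sₖ = x^{d₀} • ∑ x^{dₖ − d₀} Sₖ` when `d₀ ≤ dₖ` for all `k`. [folklore] -/
theorem sum_pow_smul_eq_pow_smul_shift [Fintype κ] (d : κ → ℕ) (S : κ → Matrix ι ι ℝ) (k₀ : κ) (hle : ∀ k, d k₀ ≤ d k)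
    (x : ℝ) : (∑ k, x ^ d k • S k) = x ^ d k₀ • ∑ k, x ^ (d k - d k₀) • S k := by
  rw [Finset.smul_sum]
  refine Finset.sum_congr rfl fun k _ => ?_
  rw [smul_smul, ← pow_add, Nat.add_sub_cancel' (hle k)]

omit [Fintype ι] [DecidableEq ι] [Fintype κ] in
/-- At `x = 0` the shifted pencil is the end letter (strictly smallest exponent). [folklore] -/
theorem shift_eval_zero [Fintype κ] [DecidableEq κ] (d : κ → ℕ) (S : κ → Matrix ι ι ℝ) (k₀ : κ)
    (hbot : ∀ k, k ≠ k₀ → d k₀ < d k) : (∑ k, (0 : ℝ) ^ (d k - d k₀) • S k) = S k₀ := by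
  rw [Finset.sum_eq_single k₀]
  · simp
  · intro k _ hk
    have hne : d k - d k₀ ≠ 0 := by have := hbot k hk; omega
    rw [zero_pow hne, zero_smul]
  · intro h; exact absurd (Finset.mem_univ k₀) h

omit [Fintype ι] [DecidableEq ι] in
/-- A positive definite real symmetric matrix has no negative eigenvalue: its negative index is `0`. [folklore] -/
theorem card_neg_eigenvalues_eq_zero_of_posDef [Fintype ι] [DecidableEq ι] {A : Matrix ι ι ℝ} (hA : A.IsHermitian)
    (hP : A.PosDef) : Fintype.card {j // hA.eigenvalues j < 0} = 0 := by
  rw [Fintype.card_eq_zero_iff]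
  refine ⟨fun j => ?_⟩
  have h := hP.eigenvalues_pos j.1
  exact absurd j.2 (not_lt.mpr h.le)

/-! ### The bottom end -/

/-- **DEAD DEFINITE END (bottom).**  If the letter of strictly smallest exponent is positive definite and `det P(x) ≠ 0` for all
`x ∈ (0, T]`, then `P(x) ≻ 0` on `(0, T]`. [folklore] -/
theorem posDef_of_posDef_bottom [DecidableEq κ] (d : κ → ℕ) (S : κ → Matrix ι ι ℝ) (hS : ∀ k, (S k).IsSymm) (k₀ : κ)
    (hbot : ∀ k, k ≠ k₀ → d k₀ < d k) (hPD : (S k₀).PosDef) {T : ℝ}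
    (hno : ∀ x ∈ Set.Ioc (0 : ℝ) T, (∑ k, x ^ d k • S k).det ≠ 0) :
    ∀ x ∈ Set.Ioc (0 : ℝ) T, (∑ k, x ^ d k • S k).PosDef := by
  intro x hx
  have hle : ∀ k, d k₀ ≤ d k := fun k => by
    by_cases h : k = k₀
    · rw [h]
    · exact (hbot k h).le
  have hfac : ∀ y : ℝ, (∑ k, y ^ d k • S k) = y ^ d k₀ • ∑ k, y ^ (d k - d k₀) • S k :=
    sum_pow_smul_eq_pow_smul_shift d S k₀ hle
  have hQ0 : (∑ k, (0 : ℝ) ^ (d k - d k₀) • S k) = S k₀ := shift_eval_zero d S k₀ hbot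
  -- the shifted pencil has no singular scale on `[0, x]`
  have hnoQ : ∀ y ∈ Set.Icc (0 : ℝ) x, (∑ k, y ^ (fun k => d k - d k₀) k • S k).det ≠ 0 := by
    intro y hy
    rcases eq_or_lt_of_le hy.1 with h0 | hpos
    · rw [← h0, hQ0]; exact hPD.det_pos.ne'
    · intro hdet
      apply hno y ⟨hpos, hy.2.trans hx.2⟩
      rw [hfac y, det_smul, hdet, mul_zero]
  have hconst := negIndex_eq_of_det_ne_zero_Icc (fun k => d k - d k₀) S hS hx.1.le hnoQ
  have h0 : Fintype.card {j //
      (Inertia.isHermitian_pencil (fun k => d k - d k₀) S hS 0).eigenvalues j < 0} = 0 := by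
    have hP0 : (∑ k, (0 : ℝ) ^ (fun k => d k - d k₀) k • S k).PosDef := by
      show (∑ k, (0 : ℝ) ^ (d k - d k₀) • S k).PosDef
      rw [hQ0]; exact hPD
    exact card_neg_eigenvalues_eq_zero_of_posDef _ hP0
  rw [h0] at hconst
  have hQx : (∑ k, x ^ (fun k => d k - d k₀) k • S k).PosDef :=
    posDef_of_negIndex_eq_zero _ hconst (hnoQ x ⟨hx.1.le, le_rfl⟩)
  rw [hfac x]
  exact hQx.smul (pow_pos hx.1 _)

/-! ### The top end (reversal `u = x⁻¹`) -/

omit [Fintype ι] [DecidableEq ι] [Fintype κ] in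
/-- Reversal identity: `∑ u^{d₀ − dₖ} Sₖ = u^{d₀} • ∑ (u⁻¹)^{dₖ} Sₖ` for `u ≠ 0` and `dₖ ≤ d₀`. [folklore] -/
theorem sum_pow_sub_smul_eq [Fintype κ] (d : κ → ℕ) (S : κ → Matrix ι ι ℝ) (k₀ : κ) (hle : ∀ k, d k ≤ d k₀)
    {u : ℝ} (hu : u ≠ 0) : (∑ k, u ^ (d k₀ - d k) • S k) = u ^ d k₀ • ∑ k, u⁻¹ ^ d k • S k := by
  rw [Finset.smul_sum]
  refine Finset.sum_congr rfl fun k _ => ?_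
  rw [smul_smul]
  congr 1
  rw [inv_pow, ← div_eq_mul_inv, eq_div_iff (pow_ne_zero _ hu), ← pow_add, Nat.sub_add_cancel (hle k)]

/-- **DEAD DEFINITE END (top).**  If the letter of strictly largest exponent is positive definite and `det P(x) ≠ 0` for all `x ≥ T`
(`T > 0`), then `P(x) ≻ 0` for all `x ≥ T`. [folklore] -/
theorem posDef_of_posDef_top [DecidableEq κ] (d : κ → ℕ) (S : κ → Matrix ι ι ℝ) (hS : ∀ k, (S k).IsSymm) (k₀ : κ)
    (htop : ∀ k, k ≠ k₀ → d k < d k₀) (hPD : (S k₀).PosDef) {T : ℝ} (hT : 0 < T)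
    (hno : ∀ x : ℝ, T ≤ x → (∑ k, x ^ d k • S k).det ≠ 0) :
    ∀ x : ℝ, T ≤ x → (∑ k, x ^ d k • S k).PosDef := by
  intro x hTx
  have hx : 0 < x := hT.trans_le hTx
  have hle : ∀ k, d k ≤ d k₀ := fun k => by
    by_cases h : k = k₀
    · rw [h]
    · exact (htop k h).le
  -- the reversed pencil `u ↦ ∑ u^{d₀ − dₖ} Sₖ` has bottom letter `S k₀` and no singular scale on `(0, T⁻¹]`
  have hbot' : ∀ k, k ≠ k₀ → (fun k => d k₀ - d k) k₀ < (fun k => d k₀ - d k) k := by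
    intro k hk
    have := htop k hk
    show d k₀ - d k₀ < d k₀ - d k
    omega
  have hno' : ∀ u ∈ Set.Ioc (0 : ℝ) T⁻¹, (∑ k, u ^ (fun k => d k₀ - d k) k • S k).det ≠ 0 := by
    intro u hu hdet
    have hu0 : u ≠ 0 := hu.1.ne'
    have hTu : T ≤ u⁻¹ := by
      rw [le_inv_comm₀ hT hu.1]
      exact hu.2
    apply hno u⁻¹ hTu
    have hrev : (∑ k, u ^ (d k₀ - d k) • S k) = u ^ d k₀ • ∑ k, u⁻¹ ^ d k • S k :=
      sum_pow_sub_smul_eq d S k₀ hle hu0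
    change (∑ k, u ^ (d k₀ - d k) • S k).det = 0 at hdet
    rw [hrev, det_smul] at hdet
    rcases mul_eq_zero.mp hdet with h | h
    · exact absurd h (pow_ne_zero _ (pow_ne_zero _ hu0))
    · exact h
  have hxinv : x⁻¹ ∈ Set.Ioc (0 : ℝ) T⁻¹ :=
    ⟨inv_pos.mpr hx, by rw [inv_le_inv₀ hx hT]; exact hTx⟩
  have hQ := posDef_of_posDef_bottom (fun k => d k₀ - d k) S hS k₀ hbot' hPD hno' x⁻¹ hxinv
  have hrevx : (∑ k, x⁻¹ ^ (d k₀ - d k) • S k) = x⁻¹ ^ d k₀ • ∑ k, x ^ d k • S k := by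
    have := sum_pow_sub_smul_eq d S k₀ hle (inv_ne_zero hx.ne')
    rw [inv_inv] at this
    exact this
  have hP : (∑ k, x ^ d k • S k) = x ^ d k₀ • ∑ k, x⁻¹ ^ (fun k => d k₀ - d k) k • S k := by
    show (∑ k, x ^ d k • S k) = x ^ d k₀ • ∑ k, x⁻¹ ^ (d k₀ - d k) • S k
    rw [hrevx, smul_smul, ← mul_pow, mul_inv_cancel₀ hx.ne', one_pow, one_smul]
  rw [hP]
  exact hQ.smul (pow_pos hx _)

/-! ### Negative definite ends -/

omit [Fintype ι] [DecidableEq ι] [Fintype κ] in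
/-- The pencil of the negated letters is the negated pencil. [folklore] -/
theorem sum_pow_smul_neg [Fintype κ] (d : κ → ℕ) (S : κ → Matrix ι ι ℝ) (x : ℝ) :
    (∑ k, x ^ d k • (fun k => -S k) k) = -∑ k, x ^ d k • S k := by
  rw [← Finset.sum_neg_distrib]
  exact Finset.sum_congr rfl fun k _ => smul_neg _ _

/-- **Dead negative definite end (bottom)**: `−S k₀ ≻ 0` (bottom letter negative definite) and `det P ≠ 0` on `(0, T]` give `−P(x) ≻ 0`
there. [folklore] -/
theorem posDef_neg_of_posDef_neg_bottom [DecidableEq κ] (d : κ → ℕ) (S : κ → Matrix ι ι ℝ) (hS : ∀ k, (S k).IsSymm)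
    (k₀ : κ) (hbot : ∀ k, k ≠ k₀ → d k₀ < d k) (hND : (-S k₀).PosDef) {T : ℝ}
    (hno : ∀ x ∈ Set.Ioc (0 : ℝ) T, (∑ k, x ^ d k • S k).det ≠ 0) :
    ∀ x ∈ Set.Ioc (0 : ℝ) T, (-∑ k, x ^ d k • S k).PosDef := by
  intro x hx
  have hS' : ∀ k, ((fun k => -S k) k).IsSymm := fun k => (hS k).neg
  have hno' : ∀ y ∈ Set.Ioc (0 : ℝ) T, (∑ k, y ^ d k • (fun k => -S k) k).det ≠ 0 := by
    intro y hy
    rw [sum_pow_smul_neg, det_neg]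
    exact mul_ne_zero (pow_ne_zero _ (by norm_num)) (hno y hy)
  have h := posDef_of_posDef_bottom d (fun k => -S k) hS' k₀ hbot hND hno' x hx
  rwa [sum_pow_smul_neg] at h

/-- **Dead negative definite end (top)**: `−S k₀ ≻ 0` (top letter negative definite) and `det P ≠ 0` on `[T, ∞)`, `T > 0`, give
`−P(x) ≻ 0` there. [folklore] -/
theorem posDef_neg_of_posDef_neg_top [DecidableEq κ] (d : κ → ℕ) (S : κ → Matrix ι ι ℝ) (hS : ∀ k, (S k).IsSymm)
    (k₀ : κ) (htop : ∀ k, k ≠ k₀ → d k < d k₀) (hND : (-S k₀).PosDef) {T : ℝ} (hT : 0 < T)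
    (hno : ∀ x : ℝ, T ≤ x → (∑ k, x ^ d k • S k).det ≠ 0) :
    ∀ x : ℝ, T ≤ x → (-∑ k, x ^ d k • S k).PosDef := by
  intro x hTx
  have hS' : ∀ k, ((fun k => -S k) k).IsSymm := fun k => (hS k).neg
  have hno' : ∀ y : ℝ, T ≤ y → (∑ k, y ^ d k • (fun k => -S k) k).det ≠ 0 := by
    intro y hy
    rw [sum_pow_smul_neg, det_neg]
    exact mul_ne_zero (pow_ne_zero _ (by norm_num)) (hno y hy)
  have h := posDef_of_posDef_top d (fun k => -S k) hS' k₀ htop hND hT hno' x hTx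
  rwa [sum_pow_smul_neg] at h

/-! ### The flag reading: window carriers beyond a definite end never alternate -/

omit [Fintype ι] [DecidableEq ι] [Fintype κ] in
/-- A principal compression, in any frame with injective `C.mulVec`, of a positive definite real matrix has positive determinant.
[folklore] -/
theorem det_frame_minor_pos [Fintype ι] [DecidableEq ι] {m' : Type} [Fintype m'] [DecidableEq m'] {A : Matrix ι ι ℝ}
    (hA : A.PosDef) (C : Matrix ι ι ℝ) (hC : Function.Injective C.mulVec) (f : m' → ι) (hf : Function.Injective f) :
    0 < ((Cᵀ * A * C).submatrix f f).det := by
  have hC' : (Cᴴ * A * C).PosDef := hA.conjTranspose_mul_mul_same hC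
  rw [conjTranspose_eq_transpose_of_trivial] at hC'
  exact (hC'.submatrix hf).det_pos

/-- **THE FLAG READING (top end).**  With a positive definite top letter and no determinant root on `[T, ∞)` (`T > 0`), EVERY window
carrier of the flag certificate — the determinant of any principal compression of `P(x)` in any frame `C` with injective `C.mulVec` —
is positive at every scale `x ≥ T`. [folklore] -/
theorem det_frame_minor_pos_of_posDef_top [DecidableEq κ] {m' : Type} [Fintype m'] [DecidableEq m'] (d : κ → ℕ)
    (S : κ → Matrix ι ι ℝ) (hS : ∀ k, (S k).IsSymm) (k₀ : κ) (htop : ∀ k, k ≠ k₀ → d k < d k₀) (hPD : (S k₀).PosDef)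
    {T : ℝ} (hT : 0 < T) (hno : ∀ x : ℝ, T ≤ x → (∑ k, x ^ d k • S k).det ≠ 0)
    (C : Matrix ι ι ℝ) (hC : Function.Injective C.mulVec) (f : m' → ι) (hf : Function.Injective f) :
    ∀ x : ℝ, T ≤ x → 0 < ((Cᵀ * (∑ k, x ^ d k • S k) * C).submatrix f f).det :=
  fun x hx => det_frame_minor_pos (posDef_of_posDef_top d S hS k₀ htop hPD hT hno x hx) C hC f hf

/-- **No window alternation beyond a definite top end**: two scales `T ≤ x, y` never give a window carrier opposite signs — the
within-window hypothesis of `Census.Graft.exists_flag_certificate` cannot be met there; a far letter at a positive definite end is worth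
exactly the `m` junction alternations of the graft law. [folklore] -/
theorem not_alternating_frame_minor_of_posDef_top [DecidableEq κ] {m' : Type} [Fintype m'] [DecidableEq m'] (d : κ → ℕ)
    (S : κ → Matrix ι ι ℝ) (hS : ∀ k, (S k).IsSymm) (k₀ : κ) (htop : ∀ k, k ≠ k₀ → d k < d k₀) (hPD : (S k₀).PosDef)
    {T : ℝ} (hT : 0 < T) (hno : ∀ x : ℝ, T ≤ x → (∑ k, x ^ d k • S k).det ≠ 0)
    (C : Matrix ι ι ℝ) (hC : Function.Injective C.mulVec) (f : m' → ι) (hf : Function.Injective f)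
    {x y : ℝ} (hx : T ≤ x) (hy : T ≤ y) :
    ¬ ((Cᵀ * (∑ k, x ^ d k • S k) * C).submatrix f f).det *
        ((Cᵀ * (∑ k, y ^ d k • S k) * C).submatrix f f).det < 0 :=
  not_lt.mpr (mul_pos (det_frame_minor_pos_of_posDef_top d S hS k₀ htop hPD hT hno C hC f hf x hx)
    (det_frame_minor_pos_of_posDef_top d S hS k₀ htop hPD hT hno C hC f hf y hy)).le

/-- **The same at a negative definite top end**: the carriers of EVEN size are positive and those of ODD size negative beyond `T`, so
again no window alternates (`det (−M) = (−1)^{card} det M`). [folklore] -/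
theorem not_alternating_frame_minor_of_negDef_top [DecidableEq κ] {m' : Type} [Fintype m'] [DecidableEq m'] (d : κ → ℕ)
    (S : κ → Matrix ι ι ℝ) (hS : ∀ k, (S k).IsSymm) (k₀ : κ) (htop : ∀ k, k ≠ k₀ → d k < d k₀) (hND : (-S k₀).PosDef)
    {T : ℝ} (hT : 0 < T) (hno : ∀ x : ℝ, T ≤ x → (∑ k, x ^ d k • S k).det ≠ 0)
    (C : Matrix ι ι ℝ) (hC : Function.Injective C.mulVec) (f : m' → ι) (hf : Function.Injective f)
    {x y : ℝ} (hx : T ≤ x) (hy : T ≤ y) :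
    ¬ ((Cᵀ * (∑ k, x ^ d k • S k) * C).submatrix f f).det *
        ((Cᵀ * (∑ k, y ^ d k • S k) * C).submatrix f f).det < 0 := by
  have key : ∀ z : ℝ, T ≤ z → ((Cᵀ * (∑ k, z ^ d k • S k) * C).submatrix f f).det
      = (-1) ^ Fintype.card m' * ((Cᵀ * (-∑ k, z ^ d k • S k) * C).submatrix f f).det := by
    intro z _
    have hneg : (Cᵀ * (-∑ k, z ^ d k • S k) * C).submatrix f f = -((Cᵀ * (∑ k, z ^ d k • S k) * C).submatrix f f) := by
      rw [Matrix.mul_neg, Matrix.neg_mul]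
      rfl
    rw [hneg, det_neg, ← mul_assoc, ← pow_add, ← two_mul, pow_mul]
    norm_num
  have hpx := det_frame_minor_pos (posDef_neg_of_posDef_neg_top d S hS k₀ htop hND hT hno x hx) C hC f hf
  have hpy := det_frame_minor_pos (posDef_neg_of_posDef_neg_top d S hS k₀ htop hND hT hno y hy) C hC f hf
  rw [key x hx, key y hy]
  have hsq : 0 < ((-1 : ℝ) ^ Fintype.card m') * ((-1 : ℝ) ^ Fintype.card m') := by
    rw [← pow_add, ← two_mul, pow_mul]; norm_num
  exact not_lt.mpr (by nlinarith [mul_pos hpx hpy])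

end Summit.ValiantsHypothesis.ValiantsHypothesis.Theorems.LacunarySymmetroidMatrixDescartes.Census.DeadEnd
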